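import Summits.NavierStokesRegularity.NavierStokesRegularity.Theorems.AdaptedFrequencyFrequencyRigidityFlatReduction
import Literature.Analysis.FluidPDE.LocalTypeI
import HarnessLib

/-!
# Crux `FrequencyRigidity` (stmt-NavierStokesRegularity-2955), line `scaled-energy-split`:
# flat inhabitants are BACKWARD-SINGULAR at the pole — tools

Helper file 1 of 2 (`--supports stmt-NavierStokesRegularity-2955`; theorems only, sorry-free): the
context-free lemmas (Landau-type gradient bound from the mean value inequality, essential bounds are
pointwise bounds for continuous functions on open sets, `exp(−y) ≤ 2/y²`, rational-function algebra of the
main estimate).  File 2 (`AdaptedFrequencyFrequencyRigidityFlatBackwardSingular.lean`) proves the leaf.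
Leaf of Stub 2
(`stub_finiteScaledEnergyLiouville`, the finite Albritton–Barker-energy piece): a *flat inhabitant* — a
jointly smooth field `v` on `ℝ³ × (−∞,0)` with the scale-invariant bounds `‖Dᵏv(t)‖ ≤ C'_k (−t)^{−(k+1)/2}`
(`k = 1, 2`), an adapted two-sided Gaussian-comparable kernel `K` at the pole `(0,0)` and the EXACT
enstrophy law `H(t) = ∫ ‖curl v(t)‖² K(t) = A(−t)⁻²`, `A > 0` (the normal form every witness of the crux
takes, `TwoEndedPinning.stub_flatReduction`) — is NOT essentially bounded on any backward parabolic ball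
`Q((0,0), r)`: the space–time origin is a singular point in the backward sense of Albritton–Barker 2019
(`IsBackwardSingularPoint v 0`).  This is the hypothesis under which the staffed target
`NoTypeIRateProfile` (stmt-1588) and Seregin–Šverák's axisymmetric theorem conclude, so it is the hinge
of the bridges `Stub 2 ⇐ stmt-1588` and of the axisymmetric leaf of Stub 2.

Proof (physical variables, no local regularity theory).  If `‖v‖ ≤ M` on `Q((0,0),r)`, the mean value
inequality with the GLOBAL bound `‖D²v(t)‖ ≤ C'₂(−t)^{−3/2}` gives, for `‖x‖ < r/2`, `0 < h < r/2`,
`‖Dv(t,x)‖ ≤ 2M/h + C'₂(−t)^{−3/2}h`; with `h = λ√(−t)` the kernel-weighted enstrophy of the ball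
`B_{r/2}` is `≤ 8‖curl‖²M²(−t)⁻¹/λ² + 2‖curl‖²C'₂²λ²(−t)⁻²`, while outside the ball the Gaussian upper
bound and `‖curl v‖ ≤ ‖curl‖C'₁(−t)⁻¹` make the contribution `o((−t)⁻²)`.  Choosing `λ` small and then
`t ↑ 0` contradicts `(−t)²H(t) = A > 0`.

## References

* D. Albritton, T. Barker, *On local Type I singularities of the Navier–Stokes equations and Liouville
  theorems*, J. Math. Fluid Mech. 21 (2019), §1 (singular points, backward form). [AlbrittonBarker2019]
* G. Koch, N. Nadirashvili, G. Seregin, V. Šverák, Acta Math. 203 (2009), §4 (scale-invariant bounds). [KochNadirashviliSereginSverak2009]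
-/

noncomputable section

set_option linter.dupNamespace false

namespace Summit.NavierStokesRegularity.NavierStokesRegularity.Theorems.FrequencyRigidity.ScaledEnergySplit

open Literature.Analysis.FluidPDE MeasureTheory Set Filter Topology Function Metric
open scoped RealInnerProductSpace ENNReal

open Summit.NavierStokesRegularity.NavierStokesRegularity.Theorems.FrequencyRigidity.Negative (E3)

/-! ## Two elementary lemmas -/

/-- **Landau-type gradient bound from the mean value inequality.**  If `f : ℝ³ → ℝ³` is `C²` with
`‖D²f‖ ≤ D` everywhere and `‖f‖ ≤ M` on the ball `B(x, ρ)`, then `‖Df(x)‖ ≤ 2M/h + D h` for every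
`0 < h < ρ` (second-order Taylor estimate along segments of length `h`). [folklore] -/
theorem norm_fderiv_le_of_norm_le {f : E3 → E3} {x : E3} {M D h ρ : ℝ} (hf : ContDiff ℝ 2 f)
    (hM : ∀ y ∈ ball x ρ, ‖f y‖ ≤ M) (hD : ∀ y, ‖iteratedFDeriv ℝ 2 f y‖ ≤ D) (hh : 0 < h)
    (hhρ : h < ρ) : ‖fderiv ℝ f x‖ ≤ 2 * M / h + D * h := by
  have hρ : 0 < ρ := hh.trans hhρ
  have hM0 : 0 ≤ M := (norm_nonneg _).trans (hM x (mem_ball_self hρ))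
  have hD0 : 0 ≤ D := (norm_nonneg _).trans (hD x)
  have hdiff : Differentiable ℝ f := hf.differentiable (by norm_num)
  have hdiff' : Differentiable ℝ (fderiv ℝ f) :=
    (hf.fderiv_right (m := 1) le_rfl).differentiable (by norm_num)
  -- Lipschitz bound on `Df` from the bound on `D²f`
  have hlip : ∀ z, ‖fderiv ℝ f z - fderiv ℝ f x‖ ≤ D * ‖z - x‖ := by
    intro z
    refine Convex.norm_image_sub_le_of_norm_fderiv_le (f := fderiv ℝ f) (s := univ)
      (fun y _ => hdiff' y) (fun y _ => ?_) convex_univ (mem_univ x) (mem_univ z)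
    rw [← norm_iteratedFDeriv_one (𝕜 := ℝ) (fderiv ℝ f), norm_iteratedFDeriv_fderiv]
    exact hD y
  refine ContinuousLinearMap.opNorm_le_of_unit_norm (by positivity) fun e he => ?_
  -- second-order Taylor estimate on the closed ball of radius `h` about `x`
  have hbound : ∀ z ∈ closedBall x h, ‖fderiv ℝ f z - fderiv ℝ f x‖ ≤ D * h := by
    intro z hz
    refine (hlip z).trans (mul_le_mul_of_nonneg_left ?_ hD0)
    rwa [mem_closedBall, dist_eq_norm] at hz
  have hy : x + h • e ∈ closedBall x h := by
    rw [mem_closedBall, dist_eq_norm, add_sub_cancel_left, norm_smul, he, mul_one,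
      Real.norm_of_nonneg hh.le]
  have hT := Convex.norm_image_sub_le_of_norm_fderiv_le' (f := f) (φ := fderiv ℝ f x)
    (fun y _ => hdiff y) hbound (convex_closedBall x h) (mem_closedBall_self hh.le) hy
  rw [add_sub_cancel_left, norm_smul, he, mul_one, Real.norm_of_nonneg hh.le] at hT
  -- `‖h • Df(x) e‖ ≤ ‖f(x + h e)‖ + ‖f x‖ + D h²`
  have hy' : x + h • e ∈ ball x ρ := by
    rw [mem_ball, dist_eq_norm, add_sub_cancel_left, norm_smul, he, mul_one, Real.norm_of_nonneg hh.le]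
    exact hhρ
  have h1 : ‖fderiv ℝ f x (h • e)‖ ≤ 2 * M + D * h * h := by
    have hb : ‖f (x + h • e) - f x‖ ≤ 2 * M :=
      (norm_sub_le _ _).trans (by linarith [hM _ hy', hM x (mem_ball_self hρ)])
    have ha : ‖fderiv ℝ f x (h • e)‖ ≤
        ‖f (x + h • e) - f x‖ + ‖f (x + h • e) - f x - fderiv ℝ f x (h • e)‖ := by
      simpa using norm_sub_le (f (x + h • e) - f x) (f (x + h • e) - f x - fderiv ℝ f x (h • e))
    linarith
  rw [map_smul, norm_smul, Real.norm_of_nonneg hh.le] at h1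
  rw [div_add' _ _ _ hh.ne', le_div_iff₀ hh]
  linarith

/-- **Essential bounds are pointwise bounds for continuous functions on open sets.**  If `f` is
continuous on the open set `U ⊆ ℝ × ℝ³` and `‖f‖_{L^∞(U)} < ∞`, then `‖f z‖ ≤ ‖f‖_{L^∞(U)}` at EVERY
point of `U` (Lebesgue measure charges open sets). [folklore] -/
theorem norm_le_of_eLpNorm_top_lt_top {F : Type*} [NormedAddCommGroup F] {f : ℝ × E3 → F}
    {U : Set (ℝ × E3)} (hU : IsOpen U) (hf : ContinuousOn f U)
    (h : eLpNorm f ∞ (volume.restrict U) < ∞) :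
    ∀ z ∈ U, ‖f z‖ ≤ (eLpNorm f ∞ (volume.restrict U)).toReal := by
  set N := eLpNorm f ∞ (volume.restrict U) with hN
  have hNtop : N ≠ ∞ := h.ne
  have hae : ∀ᵐ z ∂(volume.restrict U), ‖f z‖ₑ ≤ N := by
    rw [hN, eLpNorm_exponent_top]
    exact ae_le_eLpNormEssSup
  -- the exceptional set is open, of measure zero, hence empty
  set S : Set (ℝ × E3) := U ∩ f ⁻¹' (closedBall (0 : F) N.toReal)ᶜ with hS
  have hSo : IsOpen S := hf.isOpen_inter_preimage hU isClosed_closedBall.isOpen_compl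
  have hSU : S ⊆ U := inter_subset_left
  have hS0 : volume S = 0 := by
    have h1 : (volume.restrict U) {z | ¬ ‖f z‖ₑ ≤ N} = 0 := ae_iff.1 hae
    have h2 : S ⊆ {z | ¬ ‖f z‖ₑ ≤ N} := by
      intro z hz
      have hz' : N.toReal < ‖f z‖ := by
        have := hz.2
        rwa [mem_preimage, mem_compl_iff, mem_closedBall, dist_zero_right, not_le] at this
      simp only [mem_setOf_eq, not_le]
      rw [← ENNReal.ofReal_toReal hNtop, ← ofReal_norm]
      exact (ENNReal.ofReal_lt_ofReal_iff (ENNReal.toReal_nonneg.trans_lt hz')).2 hz'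
    have h3 : (volume.restrict U) S = 0 := measure_mono_null h2 h1
    rwa [Measure.restrict_apply hSo.measurableSet, inter_eq_left.2 hSU] at h3
  have hSe : S = ∅ := (hSo.measure_eq_zero_iff volume).1 hS0
  intro z hz
  by_contra hlt
  rw [not_le] at hlt
  have : z ∈ S := ⟨hz, by
    rw [mem_preimage, mem_compl_iff, mem_closedBall, dist_zero_right, not_le]; exact hlt⟩
  rw [hSe] at this
  exact this

/-! ## Elementary real-analysis facts -/

/-- The Gaussian tail factor against the `(−t)^{−7/2}` prefactor: `exp(−r²/(8C₂q²)) ≤ 128 C₂² q⁴ / r⁴`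
(from `y²/2 ≤ exp y` at `y = r²/(8C₂q²)`). [folklore] -/
theorem exp_neg_tail_le {r C₂ q : ℝ} (hr : 0 < r) (hC : 0 < C₂) (hq : 0 < q) :
    Real.exp (-(r ^ 2 / (8 * C₂ * q ^ 2))) ≤ 128 * C₂ ^ 2 * q ^ 4 / r ^ 4 := by
  have hy : 0 < r ^ 2 / (8 * C₂ * q ^ 2) := by positivity
  have h1 : (r ^ 2 / (8 * C₂ * q ^ 2)) ^ 2 / 2 ≤ Real.exp (r ^ 2 / (8 * C₂ * q ^ 2)) := by
    have := Real.quadratic_le_exp_of_nonneg hy.le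
    linarith
  have h2 : (r ^ 2 / (8 * C₂ * q ^ 2)) ^ 2 / 2 = (128 * C₂ ^ 2 * q ^ 4 / r ^ 4)⁻¹ := by
    field_simp
    ring
  rw [h2] at h1
  rw [Real.exp_neg]
  exact inv_le_of_inv_le₀ (by positivity) h1

/-- Powers of `q² = −t` appearing in the scale-invariant bounds, as rational functions of `q`. [folklore] -/
theorem sq_rpow_neg_div_two {q : ℝ} (hq : 0 < q) (n : ℕ) :
    (q ^ 2) ^ (-(n : ℝ) / 2) = (q ^ n)⁻¹ := by
  rw [show (-(n : ℝ) / 2) = -((n : ℝ) / 2) by ring, Real.rpow_neg (by positivity),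
    show (q ^ 2 : ℝ) = q ^ (2 : ℝ) by norm_cast, ← Real.rpow_mul hq.le,
    show (2 : ℝ) * ((n : ℝ) / 2) = (n : ℝ) by ring, Real.rpow_natCast]

/-! ### Context-free algebra for the main estimate -/

/-- `(c(u + w))² ≤ 2c²(u² + w²)`. [folklore] -/
theorem alg_sq_sum_le (c u w : ℝ) : (c * (u + w)) ^ 2 ≤ 2 * c ^ 2 * (u ^ 2 + w ^ 2) := by
  have h : (c * (u + w)) ^ 2 = 2 * c ^ 2 * (u ^ 2 + w ^ 2) - c ^ 2 * (u - w) ^ 2 := by ring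
  rw [h]
  exact sub_le_self _ (by positivity)

/-- The Taylor-step term rewritten: `D/q³ · (λq) = Dλ/q²`. [folklore] -/
theorem alg_taylor_term {D lam q : ℝ} (hq : q ≠ 0) : D / q ^ 3 * (lam * q) = D * lam / q ^ 2 := by
  field_simp

/-- The inner contribution times `q⁴`. [folklore] -/
theorem alg_inner_mul {c M D lam q : ℝ} (hq : q ≠ 0) (hl : lam ≠ 0) :
    2 * c ^ 2 * ((2 * M / (lam * q)) ^ 2 + (D * lam / q ^ 2) ^ 2) * q ^ 4 =
      8 * c ^ 2 * M ^ 2 * q ^ 2 / lam ^ 2 + 2 * c ^ 2 * D ^ 2 * lam ^ 2 := by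
  field_simp
  ring

/-- The tail contribution times `q⁴`. [folklore] -/
theorem alg_tail_mul {P C₁ E I₀ q : ℝ} (hq : q ≠ 0) :
    (P / q ^ 2) ^ 2 * (C₁ / q ^ 3) * E * I₀ * q ^ 4 = P ^ 2 * C₁ * I₀ / q ^ 3 * E := by
  field_simp

/-- The tail contribution after `exp(−y) ≤ 2/y²`, as `β q`. [folklore] -/
theorem alg_tail_final {P C₁ C₂ I₀ q r : ℝ} (hq : q ≠ 0) (hr : r ≠ 0) :
    P ^ 2 * C₁ * I₀ / q ^ 3 * (128 * C₂ ^ 2 * q ^ 4 / r ^ 4) =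
      128 * P ^ 2 * C₁ * C₂ ^ 2 * I₀ / r ^ 4 * q := by
  field_simp

/-- The exponent comparison of the Gaussian tail: for `r²/4 ≤ n` (`n = ‖x‖²`) and `q² ≤ r²`,
`−n/(C₂q²) ≤ −r²/(8C₂q²) − n/(2C₂r²)`. [folklore] -/
theorem alg_exponent_le {r C₂ q n : ℝ} (hC : 0 < C₂) (hq : 0 < q) (hr : 0 < r) (hqr : q ^ 2 ≤ r ^ 2)
    (hn : r ^ 2 / 4 ≤ n) :
    -n / (C₂ * q ^ 2) ≤ -(r ^ 2 / (8 * C₂ * q ^ 2)) + -(2 * C₂ * r ^ 2)⁻¹ * n := by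
  have hn0 : 0 ≤ n := le_trans (by positivity) hn
  have hi : r ^ 2 / (8 * C₂ * q ^ 2) ≤ n / (2 * (C₂ * q ^ 2)) := by
    rw [div_le_div_iff₀ (by positivity) (by positivity)]
    have h8 : r ^ 2 * (2 * (C₂ * q ^ 2)) = (r ^ 2 / 4) * (8 * C₂ * q ^ 2) := by ring
    rw [h8]
    exact mul_le_mul_of_nonneg_right hn (by positivity)
  have hii : (2 * C₂ * r ^ 2)⁻¹ * n ≤ n / (2 * (C₂ * q ^ 2)) := by
    rw [inv_mul_eq_div]
    exact div_le_div_of_nonneg_left hn0 (by positivity) (by nlinarith)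
  have hsum : n / (2 * (C₂ * q ^ 2)) + n / (2 * (C₂ * q ^ 2)) = n / (C₂ * q ^ 2) := by ring
  rw [neg_div, neg_mul]
  linarith

/-! ## Registered sub-goal -/

/-- **Registered sub-goal `stub_flatGradientBound` of Stub 2 (line `scaled-energy-split`)**: the
Landau-type gradient bound `‖Df(x)‖ ≤ 2M/h + Dh` (= `norm_fderiv_le_of_norm_le`, closed form). [folklore] -/
theorem stub_flatGradientBound : ∀ (f : EuclideanSpace ℝ (Fin 3) → EuclideanSpace ℝ (Fin 3)) (x : EuclideanSpace ℝ (Fin 3)) (M D h ρ : ℝ), ContDiff ℝ 2 f → (∀ y ∈ Metric.ball x ρ, ‖f y‖ ≤ M) → (∀ y : EuclideanSpace ℝ (Fin 3), ‖iteratedFDeriv ℝ 2 f y‖ ≤ D) → 0 < h → h < ρ → ‖fderiv ℝ f x‖ ≤ 2 * M / h + D * h :=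
  fun _ _ _ _ _ _ hf hM hD hh hhρ => norm_fderiv_le_of_norm_le hf hM hD hh hhρ

end Summit.NavierStokesRegularity.NavierStokesRegularity.Theorems.FrequencyRigidity.ScaledEnergySplit

end
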